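import Literature.NumberTheory.LFunctions.HalaszIntegration
import Literature.NumberTheory.LFunctions.TaoLogElliottCMization
import Literature.NumberTheory.LFunctions.MertensTail
import HarnessLib

/-!
# Halász's theorem in the Halász–Montgomery–Tenenbaum form: the multiplicative case

DISCHARGE of the named fact `Literature.NumberTheory.Sieve.halaszMontgomeryTenenbaum`
(`MatomakiRadziwill.lean`; Tenenbaum, Thm III.4.6 as quoted by Mangerel 2018, Thm 1.1.5): for
`x ≥ 3`, `T ≥ 1` and every multiplicative `f : ℕ → ℂ` with `|f| ≤ 1`,
`|∑_{n ≤ x} f(n)| ≪ x (1 + M) e^{-M} + x/√T`, `M = min_{|t| ≤ T} 𝔻(f, n^{it}; x)²`.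

The completely multiplicative case is `Halasz.norm_S_le_of_completelyMultiplicative`
(`HalaszIntegration.lean`, after Granville–Soundararajan 2003).  The extension to multiplicative
`f` is the standard convolution argument (Granville–Soundararajan 2003, end of §4, "If `f` is only
known to be multiplicative …"; Tao 2016, proof of Prop. 2.2): with `g̃ = cmLift f` (the completely
multiplicative function with the same prime values, `TaoLogElliottCMization.lean`) and the defect
`h = cmDefect f` (`f = g̃ * h`, `h(p) = 0`, `|h(p^k)| ≤ 2`, `∑_d |h(d)| d^{-2/3} ≤ C`),
`∑_{n ≤ x} f(n) = ∑_{d ≤ x} h(d) ∑_{m ≤ x/d} g̃(m)`; for `d ≤ √x` one applies the completely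
multiplicative case at `x/d` (the distance `M` only depends on prime values, and drops by at most
`2 ∑_{√x < p ≤ x} 1/p ≤ 28` when `x` is replaced by `x/d ≥ √x`, by the Mertens bounds of
`MertensElementary`/`MertensTail`), and for `d > √x` the trivial bound costs `x^{-1/6}`, which is
`≪ (1+M)e^{-M}` because `M ≤ log log x + 30`.

## Main result
- `Literature.NumberTheory.Sieve.halaszMontgomeryTenenbaum_holds : halaszMontgomeryTenenbaum`.

## References
- G. Tenenbaum, *Introduction to analytic and probabilistic number theory*, Thm III.4.6;
  P. Mangerel, PhD thesis (2018), Thm 1.1.5 (the statement vendored as the named fact).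
  [cite: Mangerel2018, Theorem 1.1.5]
- A. Granville, K. Soundararajan, *Decay of mean values of multiplicative functions*, Canad. J.
  Math. 55 (2003), Theorem 1, Corollary 1 and §4.
-/

noncomputable section

open Finset Real Complex

namespace Literature.NumberTheory.Sieve

namespace HalaszMT

open LFunctions (cmLift cmDefect defectWeight cmDefectBound)
open LFunctions.Halasz (S)

/-! ### The distance only depends on prime values; its drop from `x` to `y ≥ √x` -/

/-- `𝔻(f, w; x)²` only depends on the values of `f` at primes. [folklore] -/
theorem pretentiousDistSq_congr {f g : ℕ → ℂ} (h : ∀ p : ℕ, p.Prime → f p = g p) (w : ℕ → ℂ)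
    (x : ℝ) : pretentiousDistSq f w x = pretentiousDistSq g w x := by
  unfold pretentiousDistSq
  refine Finset.sum_congr rfl fun p hp => ?_
  rw [h p (Nat.mem_primesLE.1 hp).2]

/-- `M(x, T)` only depends on the values at primes. [folklore] -/
theorem minPretentiousDistSq_congr {f g : ℕ → ℂ} (h : ∀ p : ℕ, p.Prime → f p = g p) (x T : ℝ) :
    minPretentiousDistSq f x T = minPretentiousDistSq g x T := by
  unfold minPretentiousDistSq
  congr 1
  ext t
  exact pretentiousDistSq_congr h _ x

/-- The primes `≤ ⌊x⌋` split into those `≤ ⌊y⌋` and those in `(⌊y⌋, ⌊x⌋]`. [folklore] -/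
theorem primesLE_eq_union {y x : ℝ} (hyx : y ≤ x) :
    Nat.primesLE ⌊x⌋₊ = Nat.primesLE ⌊y⌋₊ ∪ (Finset.Ioc ⌊y⌋₊ ⌊x⌋₊).filter Nat.Prime := by
  ext p
  simp only [Finset.mem_union, Nat.mem_primesLE, Finset.mem_filter, Finset.mem_Ioc]
  have hfl : ⌊y⌋₊ ≤ ⌊x⌋₊ := Nat.floor_le_floor hyx
  constructor
  · rintro ⟨hp, hpp⟩
    by_cases h : p ≤ ⌊y⌋₊
    · exact Or.inl ⟨h, hpp⟩
    · exact Or.inr ⟨⟨by omega, hp⟩, hpp⟩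
  · rintro (⟨hp, hpp⟩ | ⟨⟨-, hp⟩, hpp⟩)
    · exact ⟨hp.trans hfl, hpp⟩
    · exact ⟨hp, hpp⟩

/-- The two pieces are disjoint. [folklore] -/
theorem disjoint_primesLE_tail (y x : ℝ) :
    Disjoint (Nat.primesLE ⌊y⌋₊) ((Finset.Ioc ⌊y⌋₊ ⌊x⌋₊).filter Nat.Prime) := by
  rw [Finset.disjoint_left]
  intro p hp hp'
  have h1 := (Nat.mem_primesLE.1 hp).1
  have h2 := (Finset.mem_Ioc.1 (Finset.mem_filter.1 hp').1).1
  omega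

/-- **Drop of the distance**: for `y ≤ x` and `1`-bounded `g, w`,
`𝔻(g,w;x)² ≤ 𝔻(g,w;y)² + 2 ∑_{⌊y⌋ < p ≤ ⌊x⌋} 1/p`. [folklore] -/
theorem pretentiousDistSq_le_add_tail {g w : ℕ → ℂ} (hg : ∀ n, ‖g n‖ ≤ 1) (hw : ∀ n, ‖w n‖ ≤ 1)
    {y x : ℝ} (hyx : y ≤ x) :
    pretentiousDistSq g w x ≤ pretentiousDistSq g w y +
      2 * ∑ p ∈ (Finset.Ioc ⌊y⌋₊ ⌊x⌋₊).filter Nat.Prime, (1 : ℝ) / p := by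
  unfold pretentiousDistSq
  rw [primesLE_eq_union hyx, Finset.sum_union (disjoint_primesLE_tail y x)]
  have htail : ∑ p ∈ (Finset.Ioc ⌊y⌋₊ ⌊x⌋₊).filter Nat.Prime,
      (1 - (g p * (starRingEnd ℂ) (w p)).re) / (p : ℝ) ≤
      2 * ∑ p ∈ (Finset.Ioc ⌊y⌋₊ ⌊x⌋₊).filter Nat.Prime, (1 : ℝ) / p := by
    rw [Finset.mul_sum]
    refine Finset.sum_le_sum fun p hp => ?_
    have hpp := (Finset.mem_filter.1 hp).2
    have hp0 : (0 : ℝ) < p := by exact_mod_cast hpp.pos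
    have h1 : -1 ≤ (g p * (starRingEnd ℂ) (w p)).re := by
      have hn : ‖g p * (starRingEnd ℂ) (w p)‖ ≤ 1 := by
        rw [norm_mul, Complex.norm_conj]
        exact mul_le_one₀ (hg p) (norm_nonneg _) (hw p)
      have := (abs_re_le_norm (g p * (starRingEnd ℂ) (w p))).trans hn
      rw [abs_le] at this
      exact this.1
    rw [div_le_iff₀ hp0]
    field_simp
    linarith
  linarith

/-- **The tail of `∑ 1/p` over `(√x, x]` is bounded**: for `x ≥ 16` and `√x ≤ y ≤ x`,
`∑_{⌊y⌋ < p ≤ ⌊x⌋} 1/p ≤ 14` (Mertens: `∑_{p ≤ x} 1/p ≤ log log x + 4` and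
`∑_{2 < p ≤ y} 1/p ≥ log log y - log log 2 - 6/log 2`). [folklore] -/
theorem sum_inv_prime_tail_le {y x : ℝ} (hx : 16 ≤ x) (hy : Real.sqrt x ≤ y) (hyx : y ≤ x) :
    ∑ p ∈ (Finset.Ioc ⌊y⌋₊ ⌊x⌋₊).filter Nat.Prime, (1 : ℝ) / p ≤ 14 := by
  have hsx : 4 ≤ Real.sqrt x := by
    rw [show (4:ℝ) = Real.sqrt 16 by rw [show (16:ℝ) = 4 ^ 2 by norm_num, Real.sqrt_sq (by norm_num)]]
    exact Real.sqrt_le_sqrt hx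
  have hy4 : 4 ≤ y := hsx.trans hy
  have hx3 : 3 ≤ x := by linarith
  -- upper bound for the full sum
  have hup := LFunctions.Halasz.sum_primesLE_inv_le hx3
  -- lower bound for the sum up to `y`
  have hlow := LFunctions.MertensBound.loglog_sub_loglog_le_sum_inv_prime (P := 2) le_rfl
    (by linarith : (2:ℝ) ≤ y)
  have hfl2 : ⌊(2:ℝ)⌋₊ = 2 := by norm_num
  rw [hfl2] at hlow
  -- split the full sum
  have hsplit : ∑ p ∈ Nat.primesLE ⌊x⌋₊, (1 : ℝ) / p =
      ∑ p ∈ Nat.primesLE ⌊y⌋₊, (1 : ℝ) / p + ∑ p ∈ (Finset.Ioc ⌊y⌋₊ ⌊x⌋₊).filter Nat.Prime, (1 : ℝ) / p := by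
    rw [primesLE_eq_union hyx, Finset.sum_union (disjoint_primesLE_tail y x)]
  -- the primes of `(2, ⌊y⌋]` are among the primes `≤ ⌊y⌋`
  have hsub : ∑ p ∈ (Finset.Ioc 2 ⌊y⌋₊).filter Nat.Prime, (1 : ℝ) / p ≤ ∑ p ∈ Nat.primesLE ⌊y⌋₊, (1 : ℝ) / p := by
    refine Finset.sum_le_sum_of_subset_of_nonneg (fun p hp => ?_) fun p _ _ => by positivity
    simp only [Finset.mem_filter, Finset.mem_Ioc] at hp
    exact Nat.mem_primesLE.2 ⟨hp.1.2, hp.2⟩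
  -- numerics: `log log x - log log y ≤ log 2`, `log log 2 ≤ 0`, `6/log 2 ≤ 8.7`
  have hlog2 : (0.6931471803 : ℝ) < Real.log 2 := Real.log_two_gt_d9
  have hlog2' : Real.log 2 < 0.6931471808 := Real.log_two_lt_d9
  have hy0 : 0 < y := by linarith
  have hlx : Real.log x ≤ 2 * Real.log y := by
    have : x ≤ y ^ 2 := by
      calc x = Real.sqrt x ^ 2 := (Real.sq_sqrt (by linarith)).symm
        _ ≤ y ^ 2 := pow_le_pow_left₀ (by linarith) hy 2
    calc Real.log x ≤ Real.log (y ^ 2) := Real.log_le_log (by linarith) this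
      _ = 2 * Real.log y := by rw [Real.log_pow]; ring
  have hly : 1 < Real.log y := by
    rw [← Real.log_exp 1]
    exact Real.log_lt_log (Real.exp_pos 1) (by have := Real.exp_one_lt_d9; linarith)
  have hll : Real.log (Real.log x) ≤ Real.log 2 + Real.log (Real.log y) := by
    rw [← Real.log_mul (by norm_num) (by linarith)]
    exact Real.log_le_log (Real.log_pos (by linarith)) hlx
  have hll2 : Real.log (Real.log 2) ≤ 0 := Real.log_nonpos (by linarith) (by linarith)
  have h6 : 6 / Real.log 2 ≤ 8.7 := by
    rw [div_le_iff₀ (by linarith)]; linarith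
  linarith

/-- `min_{|t| ≤ T} 𝔻(g, n^{it}; y)² ≥ min_{|t| ≤ T} 𝔻(g, n^{it}; x)² - 28` for `√x ≤ y ≤ x`,
`x ≥ 16`. [folklore] -/
theorem minPretentiousDistSq_ge_sub {g : ℕ → ℂ} (hg : ∀ n, ‖g n‖ ≤ 1) {y x T : ℝ} (hT : 0 ≤ T)
    (hx : 16 ≤ x) (hy : Real.sqrt x ≤ y) (hyx : y ≤ x) :
    minPretentiousDistSq g x T - 28 ≤ minPretentiousDistSq g y T := by
  have hne : Nonempty (Set.Icc (-T) T) := ⟨⟨0, by simp [hT]⟩⟩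
  unfold minPretentiousDistSq
  refine le_ciInf fun t => ?_
  have hw : ∀ n : ℕ, ‖(fun n : ℕ => (n : ℂ) ^ (((t : ℝ) : ℂ) * I)) n‖ ≤ 1 := by
    intro n
    rcases Nat.eq_zero_or_pos n with rfl | hn
    · rcases eq_or_ne ((((t : ℝ) : ℂ)) * I) 0 with h0 | h0
      · simp [h0]
      · simp [Complex.zero_cpow h0]
    · simp only; rw [Complex.norm_natCast_cpow_of_pos hn]; simp
  have htail := pretentiousDistSq_le_add_tail hg hw hyx
  have h14 := sum_inv_prime_tail_le hx hy hyx
  have hinf : (⨅ s : Set.Icc (-T) T,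
      pretentiousDistSq g (fun n : ℕ => (n : ℂ) ^ (((s : ℝ) : ℂ) * I)) x) ≤
      pretentiousDistSq g (fun n : ℕ => (n : ℂ) ^ (((t : ℝ) : ℂ) * I)) x := by
    refine ciInf_le ⟨0, ?_⟩ t
    rintro _ ⟨s, rfl⟩
    refine pretentiousDistSq_nonneg hg (fun n => ?_) x
    rcases Nat.eq_zero_or_pos n with rfl | hn
    · rcases eq_or_ne ((((s : ℝ) : ℂ)) * I) 0 with h0 | h0
      · simp [h0]
      · simp [Complex.zero_cpow h0]
    · rw [Complex.norm_natCast_cpow_of_pos hn]; simp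
  linarith

/-- `(1+M') e^{-M'} ≤ e^{c} (1+M) e^{-M}` when `M - c ≤ M'`, `M, M', c ≥ 0`. [folklore] -/
theorem one_add_mul_exp_neg_le_of_sub_le {M M' c : ℝ} (hM : 0 ≤ M) (hM' : 0 ≤ M') (hc : 0 ≤ c)
    (h : M - c ≤ M') : (1 + M') * Real.exp (-M') ≤ Real.exp c * ((1 + M) * Real.exp (-M)) := by
  rcases le_or_gt c M with hcM | hcM
  · -- `M - c ≥ 0`
    have h1 := LFunctions.Tao2016.one_add_mul_exp_neg_le (by linarith : 0 ≤ M - c) h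
    refine h1.trans ?_
    rw [show -(M - c) = c + -M by ring, Real.exp_add]
    have : 0 ≤ Real.exp c * Real.exp (-M) := by positivity
    nlinarith
  · -- `M < c`: the left side is `≤ 1 ≤ e^c (1+M) e^{-M}` since `(1+M)e^{-M} ≥ (1+c)e^{-c}`
    have h1 := LFunctions.Tao2016.one_add_mul_exp_neg_le (le_refl (0:ℝ)) hM'
    simp only [add_zero, neg_zero, Real.exp_zero, mul_one] at h1
    have h2 := LFunctions.Tao2016.one_add_mul_exp_neg_le hM hcM.le
    have h3 : Real.exp c * ((1 + c) * Real.exp (-c)) = 1 + c := by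
      rw [show Real.exp c * ((1 + c) * Real.exp (-c)) = (1 + c) * (Real.exp c * Real.exp (-c)) by ring,
        ← Real.exp_add, add_neg_cancel, Real.exp_zero, mul_one]
    have h4 : Real.exp c * ((1 + c) * Real.exp (-c)) ≤ Real.exp c * ((1 + M) * Real.exp (-M)) :=
      mul_le_mul_of_nonneg_left h2 (Real.exp_pos c).le
    linarith

/-! ### The convolution identity `∑_{n ≤ x} f = ∑_d h(d) S_{g̃}(x/d)` -/

/-- For `f = g̃ * h` (`g̃ = cmLift f`, `h = cmDefect f`):
`∑_{n ≤ X} f(n) = ∑_{d ≤ X} h(d) ∑_{m ≤ X/d} g̃(m)`. [cite: TaoFMP2016, proof of Proposition 2.2] -/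
theorem sum_eq_sum_cmDefect_mul (f : ArithmeticFunction ℂ) (X : ℕ) :
    ∑ n ∈ Finset.Icc 1 X, f n = ∑ d ∈ Finset.Icc 1 X, cmDefect f d * ∑ m ∈ Finset.Icc 1 (X / d), cmLift f m := by
  conv_lhs => rw [← LFunctions.cmLift_mul_cmDefect f, mul_comm]
  have h1 : ∀ n : ℕ, (cmDefect f * cmLift f) n =
      ∑ d ∈ n.divisors, cmDefect f d * cmLift f (n / d) := by
    intro n
    rw [ArithmeticFunction.mul_apply, Nat.sum_divisorsAntidiagonal (fun a b => cmDefect f a * cmLift f b)]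
  simp_rw [h1]
  rw [LFunctions.Halasz.sum_Icc_sum_divisors_eq (fun d n => cmDefect f d * cmLift f (n / d)) X]
  refine Finset.sum_congr rfl fun d hd => ?_
  rw [Finset.mul_sum]
  refine Finset.sum_congr rfl fun m _ => ?_
  have hd1 : 0 < d := (Finset.mem_Icc.1 hd).1
  rw [Nat.mul_div_cancel_left m hd1]

/-! ### Small elementary bounds -/

/-- `1/d ≤ d^{-2/3}` for `d ≥ 1`. [folklore] -/
theorem inv_le_rpow_neg_two_thirds {d : ℕ} (hd : 1 ≤ d) :
    (1 : ℝ) / d ≤ (d : ℝ) ^ (-(2 / 3 : ℝ)) := by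
  have hd' : (1 : ℝ) ≤ d := by exact_mod_cast hd
  rw [one_div, ← Real.rpow_neg_one]
  exact Real.rpow_le_rpow_of_exponent_le hd' (by norm_num)

/-- `log x ≤ 6 x^{1/6}` hence `x^{-1/6} ≤ 6 / log x` (`x > 1`). [folklore] -/
theorem rpow_neg_sixth_le {x : ℝ} (hx : 1 < x) : x ^ (-(1 / 6 : ℝ)) ≤ 6 / Real.log x := by
  have hx0 : 0 < x := by linarith
  have hlx : 0 < Real.log x := Real.log_pos hx
  have h1 : Real.log x ≤ 6 * x ^ (1 / 6 : ℝ) := by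
    have := Real.log_le_rpow_div hx0.le (by norm_num : (0:ℝ) < 1 / 6)
    rw [le_div_iff₀ (by norm_num)] at this
    linarith
  rw [le_div_iff₀ hlx, Real.rpow_neg hx0.le]
  have hpos : 0 < x ^ (1 / 6 : ℝ) := Real.rpow_pos_of_pos hx0 _
  calc (x ^ (1 / 6 : ℝ))⁻¹ * Real.log x ≤ (x ^ (1 / 6 : ℝ))⁻¹ * (6 * x ^ (1 / 6 : ℝ)) := by gcongr
    _ = 6 := by field_simp


/-- `⌊x/d⌋ = ⌊x⌋/d`, so `S_{g̃}(x/d) = ∑_{m ≤ ⌊x⌋/d} g̃(m)`. [folklore] -/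
theorem S_div_natCast (g : ℕ → ℂ) (x : ℝ) (d : ℕ) :
    S g (x / d) = ∑ m ∈ Finset.Icc 1 (⌊x⌋₊ / d), g m := by
  unfold LFunctions.Halasz.S
  rw [Nat.floor_div_natCast]

/-- For `d > √x` (`x ≥ 1`): `d^{-1/3} ≤ x^{-1/6}`. [folklore] -/
theorem rpow_neg_third_le {x : ℝ} (hx : 1 ≤ x) {d : ℕ} (hd : Real.sqrt x < d) :
    (d : ℝ) ^ (-(1 / 3 : ℝ)) ≤ x ^ (-(1 / 6 : ℝ)) := by
  have hx0 : 0 ≤ x := by linarith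
  have hs : 0 < Real.sqrt x := Real.sqrt_pos.2 (by linarith)
  calc (d : ℝ) ^ (-(1 / 3 : ℝ)) ≤ (Real.sqrt x) ^ (-(1 / 3 : ℝ)) :=
        Real.rpow_le_rpow_of_nonpos hs hd.le (by norm_num)
    _ = x ^ (-(1 / 6 : ℝ)) := by
        rw [Real.sqrt_eq_rpow, ← Real.rpow_mul hx0]; norm_num

end HalaszMT

set_option maxHeartbeats 800000 in
-- a long bookkeeping proof (two ranges of `d`, two trivial ranges); default budget too small
open HalaszMT in
open LFunctions (cmLift cmDefect defectWeight cmDefectBound) in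
open LFunctions.Halasz (S) in
/-- **DISCHARGE of `halaszMontgomeryTenenbaum`** (Halász's theorem in the
Halász–Montgomery–Tenenbaum form, Tenenbaum Thm III.4.6 / Mangerel 2018 Thm 1.1.5, as vendored in
`MatomakiRadziwill.lean`): there is an absolute `C` such that for every multiplicative
`f : ℕ → ℂ` with `|f| ≤ 1`, all `x ≥ 3`, `T ≥ 1`,
`|∑_{n ≤ x} f(n)| ≤ C x ((1 + M) e^{-M} + 1/√T)`, `M = min_{|t| ≤ T} 𝔻(f, n^{it}; x)²`.
Proof: the completely multiplicative case `Halasz.norm_S_le_of_completelyMultiplicative`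
(Granville–Soundararajan 2003) applied to `g̃ = cmLift f` at the points `x/d`, `d ≤ √x`, and the
convolution `f = g̃ * h` (`h = cmDefect f`, `∑ |h(d)| d^{-2/3} ≤ C`); `T < 4` and `x < 16` are
trivial ranges. [cite: Mangerel2018, Theorem 1.1.5] -/
theorem halaszMontgomeryTenenbaum_holds : halaszMontgomeryTenenbaum := by
  obtain ⟨K, hK, hcore⟩ := LFunctions.Halasz.norm_S_le_of_completelyMultiplicative
  set Cdef : ℝ := LFunctions.cmDefectBound with hCdef_def
  have hCdef : 0 < Cdef := by rw [hCdef_def]; unfold LFunctions.cmDefectBound; exact Real.exp_pos _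
  set e28 : ℝ := Real.exp 28 with he28
  set e30 : ℝ := Real.exp 30 with he30
  have he28pos : 0 < e28 := Real.exp_pos _
  have he30pos : 0 < e30 := Real.exp_pos _
  have he28one : 1 ≤ e28 := by rw [he28]; exact Real.one_le_exp (by norm_num)
  refine ⟨K * e28 * Cdef + 6 * e30 * Cdef + 3 * e30 + 2, ?_⟩
  intro f hf hfb x T hx hT
  set M : ℝ := minPretentiousDistSq f x T with hM
  set Φ : ℝ := (1 + M) * Real.exp (-M) with hΦ
  have hx0 : 0 < x := by linarith
  have hx1 : (1:ℝ) ≤ x := by linarith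
  have hfb' : ∀ n, ‖(f : ℕ → ℂ) n‖ ≤ 1 := hfb
  have hM0 : 0 ≤ M := minPretentiousDistSq_nonneg hfb' x (by linarith)
  have hMll : M ≤ Real.log (Real.log x) + 30 :=
    LFunctions.Halasz.minPretentiousDistSq_le_loglog hfb' hx hT
  have heM : 0 < Real.exp (-M) := Real.exp_pos _
  have hΦ0 : 0 ≤ Φ := by positivity
  have hsqT : 0 < Real.sqrt T := Real.sqrt_pos.2 (by linarith)
  have hS0 : ‖∑ n ∈ Finset.Icc 1 ⌊x⌋₊, f n‖ ≤ x := LFunctions.Halasz.norm_S_le' hfb' hx0.le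
  have hlx : 1 < Real.log x := by
    rw [← Real.log_exp 1]
    exact Real.log_lt_log (Real.exp_pos 1) (by have := Real.exp_one_lt_d9; linarith)
  -- `1/log x ≤ e30 Φ`
  have hA := LFunctions.Halasz.one_add_loglog_div_le hx hM0 hMll
  have hA1 : 1 / Real.log x ≤ e30 * Φ := by
    refine le_trans ?_ hA
    gcongr
    linarith [Real.log_nonneg hlx.le]
  have hbig : 0 ≤ K * e28 * Cdef + 6 * e30 * Cdef + 3 * e30 + 2 := by positivity
  -- trivial range `T < 4`
  by_cases hT4 : T < 4
  · have hs2 : Real.sqrt T < 2 := by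
      rw [show (2:ℝ) = Real.sqrt 4 by
        rw [show (4:ℝ) = 2 ^ 2 by norm_num, Real.sqrt_sq (by norm_num)]]
      exact Real.sqrt_lt_sqrt (by linarith) hT4
    have h12 : 1 / 2 ≤ 1 / Real.sqrt T := by
      rw [div_le_div_iff₀ (by norm_num) hsqT]; linarith
    calc ‖∑ n ∈ Finset.Icc 1 ⌊x⌋₊, f n‖ ≤ x := hS0
      _ = 2 * x * (1 / 2) := by ring
      _ ≤ 2 * x * (Φ + 1 / Real.sqrt T) := by gcongr; linarith
      _ ≤ (K * e28 * Cdef + 6 * e30 * Cdef + 3 * e30 + 2) * x * (Φ + 1 / Real.sqrt T) := by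
          gcongr; linarith [mul_nonneg (mul_nonneg hK.le he28pos.le) hCdef.le,
            mul_nonneg he30pos.le hCdef.le]
  push Not at hT4
  -- trivial range `x < 16`
  by_cases hx16 : x < 16
  · have hl16 : Real.log x ≤ 3 := by
      calc Real.log x ≤ Real.log 16 := Real.log_le_log hx0 hx16.le
        _ ≤ 3 := by
          rw [show (16:ℝ) = 2 ^ 4 by norm_num, Real.log_pow]
          have := Real.log_two_lt_d9; push_cast; linarith
    have h1 : 1 ≤ 3 * e30 * Φ := by
      have : 1 ≤ e30 * Φ * Real.log x := by
        rw [div_le_iff₀ (by linarith)] at hA1; linarith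
      nlinarith [mul_nonneg he30pos.le hΦ0]
    calc ‖∑ n ∈ Finset.Icc 1 ⌊x⌋₊, f n‖ ≤ x := hS0
      _ = x * 1 := (mul_one x).symm
      _ ≤ x * (3 * e30 * Φ) := by gcongr
      _ = 3 * e30 * x * Φ := by ring
      _ ≤ (K * e28 * Cdef + 6 * e30 * Cdef + 3 * e30 + 2) * x * (Φ + 1 / Real.sqrt T) := by
          have h2 : Φ ≤ Φ + 1 / Real.sqrt T := by
            have : 0 ≤ 1 / Real.sqrt T := by positivity
            linarith
          gcongr
          linarith [mul_nonneg (mul_nonneg hK.le he28pos.le) hCdef.le, mul_nonneg he30pos.le hCdef.le]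
  push Not at hx16
  -- main range: `x ≥ 16`, `T ≥ 4`
  set g : ℕ → ℂ := ⇑(cmLift f) with hg_def
  have hg : ∀ m n, g (m * n) = g m * g n := LFunctions.cmLift_mul f
  have hg1 : g 1 = 1 := LFunctions.cmLift_one f
  have hgb : ∀ n, ‖g n‖ ≤ 1 := LFunctions.norm_cmLift_le_one f (fun p _ => hfb p)
  have hgf : ∀ p : ℕ, p.Prime → g p = f p := fun p hp => LFunctions.cmLift_prime f hp
  have hMg : minPretentiousDistSq g x T = M := minPretentiousDistSq_congr hgf x T
  set X : ℕ := ⌊x⌋₊ with hX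
  set D : ℕ := ⌊Real.sqrt x⌋₊ with hD
  have hsx4 : 4 ≤ Real.sqrt x := by
    rw [show (4:ℝ) = Real.sqrt 16 by
      rw [show (16:ℝ) = 4 ^ 2 by norm_num, Real.sqrt_sq (by norm_num)]]
    exact Real.sqrt_le_sqrt hx16
  have hsxx : Real.sqrt x ≤ x := by
    rw [Real.sqrt_le_left hx0.le]; nlinarith
  have hDX : D ≤ X := Nat.floor_le_floor hsxx
  -- the identity and the triangle inequality
  have hid : ∑ n ∈ Finset.Icc 1 X, f n = ∑ d ∈ Finset.Icc 1 X, cmDefect f d * S g (x / d) := by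
    rw [sum_eq_sum_cmDefect_mul f X]
    refine Finset.sum_congr rfl fun d _ => ?_
    rw [S_div_natCast]
  have htri : ‖∑ n ∈ Finset.Icc 1 X, f n‖ ≤ ∑ d ∈ Finset.Icc 1 X, ‖cmDefect f d‖ * ‖S g (x / d)‖ := by
    rw [hid]
    refine (norm_sum_le _ _).trans (le_of_eq ?_)
    refine Finset.sum_congr rfl fun d _ => norm_mul _ _
  -- split `[1, X] = [1, D] ∪ (D, X]`
  have hsplit : ∑ d ∈ Finset.Icc 1 X, ‖cmDefect f d‖ * ‖S g (x / d)‖ =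
      ∑ d ∈ Finset.Icc 1 D, ‖cmDefect f d‖ * ‖S g (x / d)‖ +
        ∑ d ∈ Finset.Ioc D X, ‖cmDefect f d‖ * ‖S g (x / d)‖ := by
    rw [← Finset.sum_union]
    · congr 1
      ext d; simp only [Finset.mem_Icc, Finset.mem_union, Finset.mem_Ioc]; omega
    · rw [Finset.disjoint_left]; intro d h1 h2
      simp only [Finset.mem_Icc] at h1; simp only [Finset.mem_Ioc] at h2; omega
  -- Part 1: `d ≤ D`
  have hpart1 : ∀ d ∈ Finset.Icc 1 D, ‖cmDefect f d‖ * ‖S g (x / d)‖ ≤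
      K * e28 * (x * (Φ + 1 / Real.sqrt T)) * defectWeight f d := by
    intro d hd
    obtain ⟨hd1, hdD⟩ := Finset.mem_Icc.1 hd
    have hd0 : (0:ℝ) < d := by exact_mod_cast hd1
    have hdle : (d : ℝ) ≤ Real.sqrt x := (Nat.cast_le.2 hdD).trans (Nat.floor_le (Real.sqrt_nonneg x))
    set y : ℝ := x / d with hy
    have hy1 : Real.sqrt x ≤ y := by
      rw [hy, le_div_iff₀ hd0]
      calc Real.sqrt x * d ≤ Real.sqrt x * Real.sqrt x := by gcongr
        _ = x := Real.mul_self_sqrt hx0.le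
    have hyx : y ≤ x := by
      rw [hy, div_le_iff₀ hd0]
      have : (1:ℝ) ≤ d := by exact_mod_cast hd1
      nlinarith
    have hy3 : 3 ≤ y := by linarith
    have hc := hcore g hg hg1 hgb y T hy3 hT4
    set My : ℝ := minPretentiousDistSq g y T with hMy
    have hMy0 : 0 ≤ My := minPretentiousDistSq_nonneg hgb y (by linarith)
    have hMyM : M - 28 ≤ My := by
      have := minPretentiousDistSq_ge_sub hgb (by linarith : (0:ℝ) ≤ T) hx16 hy1 hyx
      rwa [hMg] at this
    have hΦy : (1 + My) * Real.exp (-My) ≤ e28 * Φ :=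
      one_add_mul_exp_neg_le_of_sub_le hM0 hMy0 (by norm_num) hMyM
    have hSy : ‖S g y‖ ≤ K * y * (e28 * Φ + e28 * (1 / Real.sqrt T)) := by
      refine hc.trans ?_
      gcongr
      have : 0 ≤ 1 / Real.sqrt T := by positivity
      nlinarith
    have hw : ‖cmDefect f d‖ / d ≤ defectWeight f d := by
      unfold LFunctions.defectWeight
      rw [div_eq_mul_one_div]
      exact mul_le_mul_of_nonneg_left (inv_le_rpow_neg_two_thirds hd1) (norm_nonneg _)
    calc ‖cmDefect f d‖ * ‖S g (x / d)‖ ≤ ‖cmDefect f d‖ * (K * y * (e28 * Φ + e28 * (1 / Real.sqrt T))) := by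
          gcongr
      _ = K * e28 * (x * (Φ + 1 / Real.sqrt T)) * (‖cmDefect f d‖ / d) := by
          rw [hy]; field_simp
      _ ≤ K * e28 * (x * (Φ + 1 / Real.sqrt T)) * defectWeight f d := by
          gcongr
  have hsum1 : ∑ d ∈ Finset.Icc 1 D, ‖cmDefect f d‖ * ‖S g (x / d)‖ ≤
      K * e28 * (x * (Φ + 1 / Real.sqrt T)) * Cdef := by
    calc ∑ d ∈ Finset.Icc 1 D, ‖cmDefect f d‖ * ‖S g (x / d)‖
        ≤ ∑ d ∈ Finset.Icc 1 D, K * e28 * (x * (Φ + 1 / Real.sqrt T)) * defectWeight f d :=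
          Finset.sum_le_sum hpart1
      _ = K * e28 * (x * (Φ + 1 / Real.sqrt T)) * ∑ d ∈ Finset.Icc 1 D, defectWeight f d := by
          rw [Finset.mul_sum]
      _ ≤ K * e28 * (x * (Φ + 1 / Real.sqrt T)) * Cdef := by
          gcongr
          exact LFunctions.sum_defectWeight_le f hf hfb D
  -- Part 2: `D < d ≤ X`
  have hx6 : x ^ (-(1 / 6 : ℝ)) ≤ 6 * (e30 * Φ) :=
    (rpow_neg_sixth_le (by linarith)).trans (by
      rw [show 6 / Real.log x = 6 * (1 / Real.log x) by ring]; gcongr)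
  have hpart2 : ∀ d ∈ Finset.Ioc D X, ‖cmDefect f d‖ * ‖S g (x / d)‖ ≤
      x * x ^ (-(1 / 6 : ℝ)) * defectWeight f d := by
    intro d hd
    obtain ⟨hDd, hdX⟩ := Finset.mem_Ioc.1 hd
    have hd1 : 1 ≤ d := by omega
    have hd0 : (0:ℝ) < d := by exact_mod_cast hd1
    have hdgt : Real.sqrt x < d := by
      have := Nat.lt_floor_add_one (Real.sqrt x)
      calc Real.sqrt x < (D : ℝ) + 1 := by exact_mod_cast this
        _ ≤ d := by exact_mod_cast hDd
    have hS : ‖S g (x / d)‖ ≤ x / d := LFunctions.Halasz.norm_S_le' hgb (by positivity)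
    have hrpow : (1 : ℝ) / d = (d : ℝ) ^ (-(2 / 3 : ℝ)) * (d : ℝ) ^ (-(1 / 3 : ℝ)) := by
      rw [← Real.rpow_add hd0, one_div, ← Real.rpow_neg_one]; norm_num
    calc ‖cmDefect f d‖ * ‖S g (x / d)‖ ≤ ‖cmDefect f d‖ * (x / d) := by gcongr
      _ = x * (‖cmDefect f d‖ * (d : ℝ) ^ (-(2 / 3 : ℝ))) * (d : ℝ) ^ (-(1 / 3 : ℝ)) := by
          rw [div_eq_mul_one_div x, hrpow]; ring
      _ ≤ x * (‖cmDefect f d‖ * (d : ℝ) ^ (-(2 / 3 : ℝ))) * x ^ (-(1 / 6 : ℝ)) := by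
          gcongr
          exact rpow_neg_third_le hx1 hdgt
      _ = x * x ^ (-(1 / 6 : ℝ)) * defectWeight f d := by
          unfold LFunctions.defectWeight; ring
  have hsum2 : ∑ d ∈ Finset.Ioc D X, ‖cmDefect f d‖ * ‖S g (x / d)‖ ≤ 6 * e30 * Cdef * (x * Φ) := by
    have hsub : ∑ d ∈ Finset.Ioc D X, defectWeight f d ≤ Cdef := by
      calc ∑ d ∈ Finset.Ioc D X, defectWeight f d ≤ ∑ d ∈ Finset.Icc 1 X, defectWeight f d :=
            Finset.sum_le_sum_of_subset_of_nonneg (fun d hd => by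
              simp only [Finset.mem_Ioc] at hd; simp only [Finset.mem_Icc]; omega)
              fun d _ _ => LFunctions.defectWeight_nonneg f d
        _ ≤ Cdef := LFunctions.sum_defectWeight_le f hf hfb X
    calc ∑ d ∈ Finset.Ioc D X, ‖cmDefect f d‖ * ‖S g (x / d)‖
        ≤ ∑ d ∈ Finset.Ioc D X, x * x ^ (-(1 / 6 : ℝ)) * defectWeight f d := Finset.sum_le_sum hpart2
      _ = x * x ^ (-(1 / 6 : ℝ)) * ∑ d ∈ Finset.Ioc D X, defectWeight f d := by rw [Finset.mul_sum]
      _ ≤ x * (6 * (e30 * Φ)) * Cdef := by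
          have h0 : 0 ≤ ∑ d ∈ Finset.Ioc D X, defectWeight f d :=
            Finset.sum_nonneg fun d _ => LFunctions.defectWeight_nonneg f d
          gcongr
      _ = 6 * e30 * Cdef * (x * Φ) := by ring
  -- conclusion
  have htot : ‖∑ n ∈ Finset.Icc 1 X, f n‖ ≤
      K * e28 * (x * (Φ + 1 / Real.sqrt T)) * Cdef + 6 * e30 * Cdef * (x * Φ) := by
    refine htri.trans ?_
    rw [hsplit]
    exact add_le_add hsum1 hsum2
  refine htot.trans ?_
  have h1 : x * Φ ≤ x * (Φ + 1 / Real.sqrt T) := by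
    have : 0 ≤ 1 / Real.sqrt T := by positivity
    nlinarith
  have h2 : 0 ≤ x * (Φ + 1 / Real.sqrt T) := by positivity
  nlinarith [mul_nonneg (mul_nonneg hK.le he28pos.le) hCdef.le, mul_nonneg he30pos.le hCdef.le,
    mul_nonneg he30pos.le h2]

end Literature.NumberTheory.Sieve
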